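/-
Origin: expansion seat `planner-pub-hodgecm-mc-period-1-g14-0`, handover #P50c r3 2026-08-20T11:21Z md5 f640c22fed32ebb7769524afc5619efe (201 l., 5 theorems; NEW additive leaf; imports sinst-1-g5 RUN-50 #1225 HodgeCM.Model.ArchConjLeviVT (kit mc/pub-hodgecm-mc-sinst-1-g5/t50-mcsinst1g5.txt r2 50671faf051a; => #1224, #1223, RUN-48 #P48a ArchConjSlotStrip) + INSTALLED HodgeCM.Model.ArchConjFrameTransport (RUN 47 (K9)); CROSS-KIT ROWDEP: install AFTER sinst #1223 < #1224 < #1225 (before or after #1226, either; does NOT import #1226 nor #P50b); drop #1225 (or #1224/#1223) => drop #P50c ALONE; ns HodgeCM.Model.ArchSideTerm; 0 proof-hole, 0 set_option maxHeartbeats, no records/Prop-defs/cites-as-hypotheses; cert lean-direct vs PKG oleans of record (RUN 48/49) + sinst #1223/#1224/#1225 compiled privately from their staged bytes 529e01c6561e/c41a253164a0/1d72a6449d55 (rc 0 / 14 s, 71 s, 33 s, 0 warn): rc 0 / 0 warn / wall 13 s; certs/axioms-generic50.log 5d509f1417f0 = #print axioms 5/5 trio, 0 proof-holeAx; JUNCTION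 with carch #CA52 certified: `pinLetterChar_kVLetters_mulSingle_cmPlace_eq_conj_of_strip_vt V c hGR hGR₂ hGR₃ h₁W hpos₂ hpos₃ (exists_strip_vt_vacuum V c.D hGR)` elaborates (certs/junction-ca52-vacuum.log b88e5b8444e8, #CA51/#CA52 compiled privately 2775532c31ef/32089fe0a59c rc 0 27 s/35 s); homonyms 0 vs PKG + theta-3/sinst-1(stage,xc)/binder-1/carch-1(pkg49,pkg50) dirs; CONTENT = carch-1-g5's ask STATUS l.13295: letter-generic (STRIP) ∧ (VT) with ONE scalar `∃ a, ∀ Φ₀ Φ₁ x₀ x₁ N, ∃ Y F, …` + the line-VACUUM instance `Y = a • ω_∞(hGR)(1,k)(follandFock (slotFrame V S) 1)` + the slot-line instance at the SAME a + carch #CA52's binder `hSV₁` VERBATIM as `exists_strip_vt_vacuum V S hGR`) NAME LIST: HodgeCM.Model.ArchSideTerm.exists_smul_forall_strip_vt . HodgeCM.Model.ArchSideTerm.exists_strip_vt_vacuum . HodgeCM.Model.ArchSideTerm.compCLM_conjFrameTransport_slotArchBox_follandFock_one (`HOME/mc/pub-hodgecm-mc-period-1-g14/stage50/HodgeCM/Model/ArchConjSlotVTGeneric.lean`,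 md5 f640c22fed32, 201 lines);
landed by the second packager p2 gen 7 (p2-g7) in gate run 50 as `HodgeCM/Model/ArchConjSlotVTGeneric.lean` (verbatim).
-/
/-
Origin: speedrun cell pub-hodgecm, MODEL-CONSTRUCTION sub-cell, lineage mc-period-1 (period lane), seat planner-pub-hodgecm-mc-period-1-g14-0
(gen 14), 2026-08-20.  Target in PKG: `HodgeCM/Model/ArchConjSlotVTGeneric.lean` (NEW additive leaf; RUN 50 material, row #P50c; imports sinst-1-g5's
RUN-50 #1225 `Model/ArchConjLeviVT` (⇒ #1224 `ArchConjLeviShape`, #1223, RUN-48 #P48a `ArchConjSlotStrip`) and theta-3's RUN-47 (K9)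
`Model/ArchConjFrameTransport`).  KERNEL only: 0 records / Prop-valued definitions / cites-as-hypotheses, 0 proof holes; closure ⊆
{propext, Classical.choice, Quot.sound}.  Asked for by carch-1-g5 (STATUS 2026-08-20T11:10:29Z: the letter-generic (STRIP) ∧ (VT) and its
instance at the two line vacua, input of the (C-Σ)′ `v₁` leaf).
-/
import Summits.HodgeConjecture.HodgeCM.Model.ArchConjLeviVT
import Summits.HodgeConjecture.HodgeCM.Model.ArchConjFrameTransport_2

/-!
# (STRIP) ∧ (VT) for the conjugated plane — LETTER-GENERIC, ONE SCALAR

sinst-1's RUN-50 capstone `Model/ArchConjSlotVT` (`hSV_holds`) states (STRIP) ∧ (VT) at the two primed slot LINE functions `linePhi`, with the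
scalar quantified per context (`∃ Y F a`).  The assembly passes through a stronger, letter-generic statement which this leaf exports:

* `exists_smul_forall_strip_vt V S hGR` — **ONE scalar `a : ℂ` for ALL slot data**: `∃ a, ∀ Φ₀ Φ₁ x₀ x₁ N, ∃ Y F,
  ⊗″(φ_N(Φ₀; x₀), φ_N(Φ₁; x₁)) = E(Y ⊗ F) ∧ Y = a • ω_∞(hGR)(1, k) ((Φ₀ ⊠ Φ₁)_X' ∘ J_S)` (`k = conjTransportK S`, `J_S = conjFrameTransport V S`,
  `(Φ₀ ⊠ Φ₁)_X' = slotArchBox Φ₀ Φ₁`): period-1's RUN-48 #P48a `exists_cmConjLineTensorFin_testFun_eq_tmul` clauses 2+3 (tensor decomposition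
  `(A_∞, M_f)` of `ω(r_F h₀)` [Weil1964 n°37 Thm 5 p. 188; MVW 1987 ch. 2 §II.1 p. 31, §II.6 p. 43] and the pure-tensor form of the see-saw tensor of two
  thin-coset test functions) + sinst-1's #1225 `exists_reindex_archFactor_eq_smul_cmArchWeilRep_cmConjSeesawMp` (`R_e (A_∞ Φ) = a • ω_∞(1,k)((R_e Φ) ∘ J_S)`
  for ONE `a` and all `Φ`, via #1224's Levi shape and #1222's continuous Schur lemma [Folland1989 Prop. (1.43), (1.50), (4.24)]) + #P48a `slotArchBox_eq`;
* `compCLM_conjFrameTransport_slotArchBox_follandFock_one V S` — at the two primed LINE VACUA the transported box is the PAIR's vacuum: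
  `(Ω'₀ ⊠ Ω'₁)_X' ∘ J_S = follandFock (slotFrame V S) 1` ((K9) `slotArchBox_follandFock_of`, `follandFock_planeFrame_dW'_conjFrameTransport` at `F = 1`
  [Folland1989 §1.7 (1.81)]);
* `exists_strip_vt_vacuum V S hGR` — carch-1's RUN-50 #CA52 binder `hSV₁` VERBATIM (`c.D ↦ S`): `∀ x₂ x₃, ∃ Y F a, …(vacua)… ∧ Y = a • ω_∞(hGR)(1,k)
  (follandFock (cmBigFrame … (dW S) … ι₁) 1)`;
* `forall_strip_vt_vacuum_of V S hGR a h` — the vacuum instance of the generic family AT THE SAME SCALAR `a`: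
  `∀ x₀ x₁ N, ∃ Y F, ⊗″(φ_N(Ω'₀; x₀), φ_N(Ω'₁; x₁)) = E(Y ⊗ F) ∧ Y = a • ω_∞(hGR)(1, k) (follandFock (slotFrame V S) 1)`;
  and `forall_strip_vt_linePhi_of` — the slot-line instance at the same `a` ((K9) `compCLM_conjFrameTransport_slotArchBox_linePhi`), i.e. the
  ∃-contents of (K10)'s `hSV` with the scalar shared with the vacuum instance.
ADDITIVE leaf (namespace `HodgeCM.Model.ArchSideTerm`): no existing declaration is touched; no records, no cited facts, no E-binder, no placeholders.
-/

set_option autoImplicit false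

noncomputable section

open scoped Matrix Kronecker Classical SchwartzMap TensorProduct
open NumberField (maximalRealSubfield IsCMField)
open NumberField.mixedEmbedding (mixedSpace)
open Literature.RepresentationTheory.HeisenbergGroup
open Literature.NumberTheory.Automorphic Literature.NumberTheory.Automorphic.UnitaryGroup Literature.NumberTheory.Weil1964
open Literature.NumberTheory.GelbartRogawski1991 Literature.NumberTheory.GelbartRogawski1991.UnitaryDualPair
open HodgeCM.Adelic HodgeCM.PerL34 HodgeCM.PerL34.TorusEmbedding
open HodgeCM.Model.HypCensus HodgeCM.Model.ArchLevi

namespace HodgeCM.Model.ArchSideTerm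

section Generic

variable {L : CMField} {ι₁ : L →+* ℂ} (V : HermSpace3 L ι₁) (S : StubTree.SeesawDatum L)
  (hGR : (cmSplittingDatum (L : Type) finProdFinEquiv (frameD V) (frameD_real V) (frameD_ne V)
    (dW S) (dW_real S) (dW_ne S)).CompatibleSplitting)

/-- **(STRIP) ∧ (VT), LETTER-GENERIC, ONE SCALAR.**  There is ONE `a : ℂ` such that for all slot functions `Φ₀ Φ₁`, base points `x₀ x₁`
and levels `N`, the conjugated see-saw tensor of the two thin-coset test functions is a pure tensor `E(Y ⊗ F)` with
`Y = a • ω_∞(hGR)(1, conjTransportK S) ((slotArchBox Φ₀ Φ₁) ∘ J_S)`. -/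
theorem exists_smul_forall_strip_vt :
    ∃ a : ℂ, ∀ (Φ₀ Φ₁ : 𝓢((Fin 3 → mixedSpace (↥(maximalRealSubfield (L : Type)))), ℂ))
      (x₀ x₁ : Fin 3 → ↥(maximalRealSubfield (L : Type))) (N : ℕ),
      ∃ (Y : 𝓢((Fin (3 * 2) → mixedSpace (↥(maximalRealSubfield (L : Type)))), ℂ))
        (F : FinSB (↥(maximalRealSubfield (L : Type))) (Fin (3 * 2))),
        cmConjLineTensorFin (L : Type) finProdFinEquiv e₁ (frameD V) (frameD_real V) (frameD_ne V) (dW S) (dW_real S) (dW_ne S)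
              (dW' S) (dW'_real S) (dW'_ne S) S.isoGL (isoGL_hg₀ S)
              (SupplyInstance.testFun (↥(maximalRealSubfield (L : Type))) (Fin 3) Φ₀ x₀ N)
              (SupplyInstance.testFun (↥(maximalRealSubfield (L : Type))) (Fin 3) Φ₁ x₁ N) =
            piSchwartzBruhatEquiv (↥(maximalRealSubfield (L : Type))) (Fin (3 * 2)) (Y ⊗ₜ F) ∧
          Y = a • HypCensus.cmArchWeilRep (L : Type) finProdFinEquiv (frameD V) (frameD_real V) (frameD_ne V)
                (dW S) (dW_real S) (dW_ne S) hGR (1, conjTransportK S)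
                (SchwartzMap.compCLMOfContinuousLinearEquiv ℂ (conjFrameTransport V S) (slotArchBox (L := L) Φ₀ Φ₁)) := by
  have hS := exists_cmConjLineTensorFin_testFun_eq_tmul V S
  obtain ⟨A, Mf, -, hAM, hbox⟩ := hS
  have hV := exists_reindex_archFactor_eq_smul_cmArchWeilRep_cmConjSeesawMp V S hGR A Mf hAM
  obtain ⟨a, ha⟩ := hV
  refine ⟨a, fun Φ₀ Φ₁ x₀ x₁ N => ?_⟩
  have hB := hbox Φ₀ Φ₁ x₀ x₁ N
  obtain ⟨f, hf⟩ := hB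
  exact ⟨_, f, hf, (ha _).trans (congrArg (fun Ψ => a • HypCensus.cmArchWeilRep (L : Type) finProdFinEquiv (frameD V) (frameD_real V)
    (frameD_ne V) (dW S) (dW_real S) (dW_ne S) hGR (1, conjTransportK S) Ψ)
    (congrArg (SchwartzMap.compCLMOfContinuousLinearEquiv ℂ (conjFrameTransport V S)) (slotArchBox_eq (L := L) Φ₀ Φ₁).symm))⟩

/-- **the transported box of the two primed LINE VACUA is the PAIR's vacuum**: `(Ω'₀ ⊠ Ω'₁) ∘ J_S = follandFock (slotFrame V S) 1`. -/
theorem compCLM_conjFrameTransport_slotArchBox_follandFock_one :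
    SchwartzMap.compCLMOfContinuousLinearEquiv ℂ (conjFrameTransport V S)
        (slotArchBox (follandFock (lineFrameOf V (dW' S) (dW'_real S) (dW'_ne S) 0) 1)
          (follandFock (lineFrameOf V (dW' S) (dW'_real S) (dW'_ne S) 1) 1)) =
      follandFock (slotFrame V S) 1 := by
  ext y
  show slotArchBox (follandFock (lineFrameOf V (dW' S) (dW'_real S) (dW'_ne S) 0) 1)
      (follandFock (lineFrameOf V (dW' S) (dW'_real S) (dW'_ne S) 1) 1) (conjFrameTransport V S y) = follandFock (slotFrame V S) 1 y
  rw [slotArchBox_follandFock_of, follandFock_planeFrame_dW'_conjFrameTransport]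
  simp only [map_one, mul_one]

/-- **the VACUUM instance at a given scalar**: from the generic family at `a`, for all base points and levels the see-saw tensor of the two
primed line-vacuum test functions is `E(Y ⊗ F)` with `Y = a • ω_∞(hGR)(1, conjTransportK S) (follandFock (slotFrame V S) 1)`. -/
theorem forall_strip_vt_vacuum_of (a : ℂ)
    (h : ∀ (Φ₀ Φ₁ : 𝓢((Fin 3 → mixedSpace (↥(maximalRealSubfield (L : Type)))), ℂ))
      (x₀ x₁ : Fin 3 → ↥(maximalRealSubfield (L : Type))) (N : ℕ),
      ∃ (Y : 𝓢((Fin (3 * 2) → mixedSpace (↥(maximalRealSubfield (L : Type)))), ℂ))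
        (F : FinSB (↥(maximalRealSubfield (L : Type))) (Fin (3 * 2))),
        cmConjLineTensorFin (L : Type) finProdFinEquiv e₁ (frameD V) (frameD_real V) (frameD_ne V) (dW S) (dW_real S) (dW_ne S)
              (dW' S) (dW'_real S) (dW'_ne S) S.isoGL (isoGL_hg₀ S)
              (SupplyInstance.testFun (↥(maximalRealSubfield (L : Type))) (Fin 3) Φ₀ x₀ N)
              (SupplyInstance.testFun (↥(maximalRealSubfield (L : Type))) (Fin 3) Φ₁ x₁ N) =
            piSchwartzBruhatEquiv (↥(maximalRealSubfield (L : Type))) (Fin (3 * 2)) (Y ⊗ₜ F) ∧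
          Y = a • HypCensus.cmArchWeilRep (L : Type) finProdFinEquiv (frameD V) (frameD_real V) (frameD_ne V)
                (dW S) (dW_real S) (dW_ne S) hGR (1, conjTransportK S)
                (SchwartzMap.compCLMOfContinuousLinearEquiv ℂ (conjFrameTransport V S) (slotArchBox (L := L) Φ₀ Φ₁))) :
    ∀ (x₀ x₁ : Fin 3 → ↥(maximalRealSubfield (L : Type))) (N : ℕ),
      ∃ (Y : 𝓢((Fin (3 * 2) → mixedSpace (↥(maximalRealSubfield (L : Type)))), ℂ))
        (F : FinSB (↥(maximalRealSubfield (L : Type))) (Fin (3 * 2))),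
        cmConjLineTensorFin (L : Type) finProdFinEquiv e₁ (frameD V) (frameD_real V) (frameD_ne V) (dW S) (dW_real S) (dW_ne S)
              (dW' S) (dW'_real S) (dW'_ne S) S.isoGL (isoGL_hg₀ S)
              (SupplyInstance.testFun (↥(maximalRealSubfield (L : Type))) (Fin 3)
                (follandFock (lineFrameOf V (dW' S) (dW'_real S) (dW'_ne S) 0) 1) x₀ N)
              (SupplyInstance.testFun (↥(maximalRealSubfield (L : Type))) (Fin 3)
                (follandFock (lineFrameOf V (dW' S) (dW'_real S) (dW'_ne S) 1) 1) x₁ N) =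
            piSchwartzBruhatEquiv (↥(maximalRealSubfield (L : Type))) (Fin (3 * 2)) (Y ⊗ₜ F) ∧
          Y = a • HypCensus.cmArchWeilRep (L : Type) finProdFinEquiv (frameD V) (frameD_real V) (frameD_ne V)
                (dW S) (dW_real S) (dW_ne S) hGR (1, conjTransportK S) (follandFock (slotFrame V S) 1) := by
  intro x₀ x₁ N
  obtain ⟨Y, F, hYF, hY⟩ := h (follandFock (lineFrameOf V (dW' S) (dW'_real S) (dW'_ne S) 0) 1)
    (follandFock (lineFrameOf V (dW' S) (dW'_real S) (dW'_ne S) 1) 1) x₀ x₁ N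
  exact ⟨Y, F, hYF, hY.trans (congrArg (fun Ψ => a • HypCensus.cmArchWeilRep (L : Type) finProdFinEquiv (frameD V) (frameD_real V)
    (frameD_ne V) (dW S) (dW_real S) (dW_ne S) hGR (1, conjTransportK S) Ψ) (compCLM_conjFrameTransport_slotArchBox_follandFock_one V S))⟩

/-- **THE VACUUM (STRIP) ∧ (VT) `hSV₁` — carch-1's binder text** (RUN-50 #CA52 `Model/ArchKTypeOfSigmaIotaConj`, hypothesis `hSV₁` of
`pinLetterChar_kVLetters_mulSingle_cmPlace_eq_conj_of_strip_vt` ∕ `lambdaExponentConj_add_eq_of_strip_vt`, with `c.D ↦ S`; frames spelled out as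
`cmBigFrame …` exactly as there): for all rational centres `x₂ x₃`, the conjugated see-saw tensor of the two primed line-VACUUM test functions is
`E(Y ⊗ F)` with `Y = a • ω_∞(hGR)(1, conjTransportK S) (follandFock (big frame of the pair) 1)`.  Feed `hSV₁ := exists_strip_vt_vacuum V c.D hGR`. -/
theorem exists_strip_vt_vacuum :
    ∀ x₂ x₃ : Fin 3 → ↥(maximalRealSubfield (L : Type)),
      ∃ (Y : 𝓢((Fin (3 * 2) → mixedSpace (↥(maximalRealSubfield (L : Type)))), ℂ))
        (F : FinSB (↥(maximalRealSubfield (L : Type))) (Fin (3 * 2))) (a : ℂ),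
        cmConjLineTensorFin (L : Type) finProdFinEquiv e₁ (frameD V) (frameD_real V) (frameD_ne V) (dW S) (dW_real S) (dW_ne S)
              (dW' S) (dW'_real S) (dW'_ne S) S.isoGL (isoGL_hg₀ S)
              (SupplyInstance.testFun (↥(maximalRealSubfield (L : Type))) (Fin 3)
                (follandFock (cmBigFrame (L : Type) e₁ (frameD V) (frameD_real V) (frameD_ne V) (lineVec (L : Type) (dW' S 0))
                  (fun _ => dW'_real S 0) (fun _ => dW'_ne S 0) ι₁) 1) x₂ 1)
              (SupplyInstance.testFun (↥(maximalRealSubfield (L : Type))) (Fin 3)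
                (follandFock (cmBigFrame (L : Type) e₁ (frameD V) (frameD_real V) (frameD_ne V) (lineVec (L : Type) (dW' S 1))
                  (fun _ => dW'_real S 1) (fun _ => dW'_ne S 1) ι₁) 1) x₃ 1) =
            piSchwartzBruhatEquiv (↥(maximalRealSubfield (L : Type))) (Fin (3 * 2)) (Y ⊗ₜ F) ∧
          Y = a • HypCensus.cmArchWeilRep (L : Type) finProdFinEquiv (frameD V) (frameD_real V) (frameD_ne V) (dW S) (dW_real S) (dW_ne S)
                hGR (1, conjTransportK S)
                (follandFock (cmBigFrame (L : Type) finProdFinEquiv (frameD V) (frameD_real V) (frameD_ne V) (dW S) (dW_real S) (dW_ne S) ι₁) 1) := by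
  intro x₂ x₃
  have hG := exists_smul_forall_strip_vt V S hGR
  obtain ⟨a, h⟩ := hG
  have hv := forall_strip_vt_vacuum_of V S hGR a h x₂ x₃ 1
  obtain ⟨Y, F, hYF, hY⟩ := hv
  exact ⟨Y, F, a, hYF, hY⟩

variable
  (hpos₀ : 0 < cmXW (L : Type) (frameD V) (lineVec (L : Type) (dW S 0)) (fun _ => dW_real S 0) ι₁ (HypCensus.cmPlace (L : Type) ι₁) 0)
  (hpos₁ : 0 < cmXW (L : Type) (frameD V) (lineVec (L : Type) (dW S 1)) (fun _ => dW_real S 1) ι₁ (HypCensus.cmPlace (L : Type) ι₁) 0)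
  (hpos₂ : 0 < cmXW (L : Type) (frameD V) (lineVec (L : Type) (dW' S 0)) (fun _ => dW'_real S 0) ι₁ (HypCensus.cmPlace (L : Type) ι₁) 0)
  (hpos₃ : 0 < cmXW (L : Type) (frameD V) (lineVec (L : Type) (dW' S 1)) (fun _ => dW'_real S 1) ι₁ (HypCensus.cmPlace (L : Type) ι₁) 0)

/-- **the SLOT-LINE instance at a given scalar** (letters of (K9)): from the generic family at `a`, the see-saw tensor of the two primed slot
test functions `φ₁(Φ'ₖ; x'ₖ)` is `E(Y ⊗ F)` with `Y = a • ω_∞(hGR)(1, conjTransportK S) Φ_X`, `Φ_X = slotArchBox (linePhi 0) (linePhi 1)` —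
the ∃-contents of (K10)'s `hSV`, with the scalar SHARED with `forall_strip_vt_vacuum_of`. -/
theorem forall_strip_vt_linePhi_of (a : ℂ)
    (h : ∀ (Φ₀ Φ₁ : 𝓢((Fin 3 → mixedSpace (↥(maximalRealSubfield (L : Type)))), ℂ))
      (x₀ x₁ : Fin 3 → ↥(maximalRealSubfield (L : Type))) (N : ℕ),
      ∃ (Y : 𝓢((Fin (3 * 2) → mixedSpace (↥(maximalRealSubfield (L : Type)))), ℂ))
        (F : FinSB (↥(maximalRealSubfield (L : Type))) (Fin (3 * 2))),
        cmConjLineTensorFin (L : Type) finProdFinEquiv e₁ (frameD V) (frameD_real V) (frameD_ne V) (dW S) (dW_real S) (dW_ne S)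
              (dW' S) (dW'_real S) (dW'_ne S) S.isoGL (isoGL_hg₀ S)
              (SupplyInstance.testFun (↥(maximalRealSubfield (L : Type))) (Fin 3) Φ₀ x₀ N)
              (SupplyInstance.testFun (↥(maximalRealSubfield (L : Type))) (Fin 3) Φ₁ x₁ N) =
            piSchwartzBruhatEquiv (↥(maximalRealSubfield (L : Type))) (Fin (3 * 2)) (Y ⊗ₜ F) ∧
          Y = a • HypCensus.cmArchWeilRep (L : Type) finProdFinEquiv (frameD V) (frameD_real V) (frameD_ne V)
                (dW S) (dW_real S) (dW_ne S) hGR (1, conjTransportK S)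
                (SchwartzMap.compCLMOfContinuousLinearEquiv ℂ (conjFrameTransport V S) (slotArchBox (L := L) Φ₀ Φ₁)))
    (N : ℕ) :
    ∃ (Y : 𝓢((Fin (3 * 2) → mixedSpace (↥(maximalRealSubfield (L : Type)))), ℂ))
      (F : FinSB (↥(maximalRealSubfield (L : Type))) (Fin (3 * 2))),
      cmConjLineTensorFin (L : Type) finProdFinEquiv e₁ (frameD V) (frameD_real V) (frameD_ne V) (dW S) (dW_real S) (dW_ne S)
            (dW' S) (dW'_real S) (dW'_ne S) S.isoGL (isoGL_hg₀ S)
            (SupplyInstance.testFun (↥(maximalRealSubfield (L : Type))) (Fin 3)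
              (linePhi V (dW' S 0) (dW'_real S 0) (dW'_ne S 0) hpos₂) (lineX₀ V (dW' S 0) (dW'_real S 0) (dW'_ne S 0) hpos₂) N)
            (SupplyInstance.testFun (↥(maximalRealSubfield (L : Type))) (Fin 3)
              (linePhi V (dW' S 1) (dW'_real S 1) (dW'_ne S 1) hpos₃) (lineX₀ V (dW' S 1) (dW'_real S 1) (dW'_ne S 1) hpos₃) N) =
          piSchwartzBruhatEquiv (↥(maximalRealSubfield (L : Type))) (Fin (3 * 2)) (Y ⊗ₜ F) ∧
        Y = a • HypCensus.cmArchWeilRep (L : Type) finProdFinEquiv (frameD V) (frameD_real V) (frameD_ne V)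
              (dW S) (dW_real S) (dW_ne S) hGR (1, conjTransportK S)
              (slotArchBox (linePhi V (dW S 0) (dW_real S 0) (dW_ne S 0) hpos₀) (linePhi V (dW S 1) (dW_real S 1) (dW_ne S 1) hpos₁)) := by
  obtain ⟨Y, F, hYF, hY⟩ := h (linePhi V (dW' S 0) (dW'_real S 0) (dW'_ne S 0) hpos₂) (linePhi V (dW' S 1) (dW'_real S 1) (dW'_ne S 1) hpos₃)
    (lineX₀ V (dW' S 0) (dW'_real S 0) (dW'_ne S 0) hpos₂) (lineX₀ V (dW' S 1) (dW'_real S 1) (dW'_ne S 1) hpos₃) N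
  exact ⟨Y, F, hYF, hY.trans (congrArg (fun Ψ => a • HypCensus.cmArchWeilRep (L : Type) finProdFinEquiv (frameD V) (frameD_real V)
    (frameD_ne V) (dW S) (dW_real S) (dW_ne S) hGR (1, conjTransportK S) Ψ)
    (compCLM_conjFrameTransport_slotArchBox_linePhi V S hpos₀ hpos₁ hpos₂ hpos₃))⟩

end Generic

end HodgeCM.Model.ArchSideTerm

end
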